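import Mathlib.Tactic.Ring
import Mathlib.Tactic.Linarith
import Mathlib.Tactic.Positivity
import Mathlib.Tactic.LinearCombination
import Mathlib.Data.Real.Basic
import Mathlib.Analysis.Real.Sqrt
import Summits.HodgeConjecture.HodgeConjecture.Theorems.WeilClassTestFormatFourTwoCrossMaxCore
import HarnessLib

/-!
# CROSS-MAX in format (4,2) — part 2/2: the theorem `crossMax_42` (hodge-weil ladder, GAPS G51b′)

Prover 2, generation 14, ADDENDUM 1 (note `run/shared/lean/b2b/hodge-weil/b2b-hweil-pv2-g14/THREE-PHASE-G14.md` ADDENDUM 1). THEOREM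
(`crossMax_42`): a centred, pure (P1, P2, P4), pairwise-ample real (4,2) configuration with `Q₂ + (3 + 2√3)·Q₄ = 0` and `Q₂ > 0` — a
maximiser of `−Q₄/Q₂`, value `2/√3 − 1` by `conjectureN_42_sharp` / `conjectureN_42_sharp_attained` — is a CROSS (null-cone) configuration:
`∃ (A₀, u₀), (u_k − u₀)² = (A_k − A₀)²` for all six roots (`CONJECTURE-N.md` §3). This is pv2-g9's CROSS-MAX conjecture (G51b′) in format
(4,2). Part 1 (`…CrossMaxCore.lean`) treats the one-sided sorted frame; this file removes the one-sidedness (outside it pv2-g13's analysis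
gives `Q₂, Q₄ ≥ 0`, `Q₄ = 0` or no configuration — incompatible with the equality and `Q₂ > 0` — or the reflected one-sided case) and the
sorting (`S₄ × S₂` symmetry; the vertex is relabelled / reflected accordingly). Pure algebra; nothing here is a case of HC, a rung or a door
edge (C22); no statement of Markman's papers is used. New cell result ⇒ Summits/.
-/

set_option linter.dupNamespace false

namespace Summit.HodgeConjecture.HodgeConjecture.WeilClassTestFormatFourTwoLambda

open Summit.HodgeConjecture.HodgeConjecture.WeilClassTestProductFormula
open Summit.HodgeConjecture.HodgeConjecture.WeilClassTestFormatFourTwo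

set_option maxHeartbeats 800000 in
/-- CROSS-MAX, SORTED FRAME (`u₁ ≤ u₂ ≤ u₃ ≤ u₄`, `v₁ ≤ v₂`): equality with `Q₂ > 0` ⇒ cross. Outside the one-sided case pv2-g13's
analysis gives `Q₂, Q₄ ≥ 0` (pattern `E F E E F E`), `Q₄ = 0` (`K = 0`) or no configuration, all incompatible with `Q₂ + (3+2√3)Q₄ = 0 < Q₂`. -/
theorem crossMax_42_sorted (A₁ A₂ A₃ A₄ B₁ B₂ u₁ u₂ u₃ u₄ v₁ v₂ : ℝ)
    (hA : A₁ + A₂ + A₃ + A₄ = B₁ + B₂) (hC : u₁ + u₂ + u₃ + u₄ = v₁ + v₂)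
    (hP1 : (A₁ ^ 2 * u₁ + A₂ ^ 2 * u₂ + A₃ ^ 2 * u₃ + A₄ ^ 2 * u₄) - (B₁ ^ 2 * v₁ + B₂ ^ 2 * v₂) = 0)
    (hP2 : (A₁ * u₁ ^ 2 + A₂ * u₂ ^ 2 + A₃ * u₃ ^ 2 + A₄ * u₄ ^ 2) - (B₁ * v₁ ^ 2 + B₂ * v₂ ^ 2) = 0)
    (hP4 : (u₁ ^ 3 + u₂ ^ 3 + u₃ ^ 3 + u₄ ^ 3) - (v₁ ^ 3 + v₂ ^ 3) = 0)
    (m₁₁ : |u₁ - v₁| ≤ A₁ - B₁) (m₂₁ : |u₂ - v₁| ≤ A₂ - B₁) (m₃₁ : |u₃ - v₁| ≤ A₃ - B₁) (m₄₁ : |u₄ - v₁| ≤ A₄ - B₁)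
    (m₁₂ : |u₁ - v₂| ≤ A₁ - B₂) (m₂₂ : |u₂ - v₂| ≤ A₂ - B₂) (m₃₂ : |u₃ - v₂| ≤ A₃ - B₂) (m₄₂ : |u₄ - v₂| ≤ A₄ - B₂)
    (o₁₂ : u₁ ≤ u₂) (o₂₃ : u₂ ≤ u₃) (o₃₄ : u₃ ≤ u₄) (ov : v₁ ≤ v₂)
    (hQ : (1 / 2) * ((A₁ ^ 2 + A₂ ^ 2 + A₃ ^ 2 + A₄ ^ 2) - (B₁ ^ 2 + B₂ ^ 2)) * ((u₁ ^ 2 + u₂ ^ 2 + u₃ ^ 2 + u₄ ^ 2) - (v₁ ^ 2 + v₂ ^ 2))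
        + ((A₁ * u₁ + A₂ * u₂ + A₃ * u₃ + A₄ * u₄) - (B₁ * v₁ + B₂ * v₂)) ^ 2
        - 3 * ((A₁ ^ 2 * u₁ ^ 2 + A₂ ^ 2 * u₂ ^ 2 + A₃ ^ 2 * u₃ ^ 2 + A₄ ^ 2 * u₄ ^ 2) - (B₁ ^ 2 * v₁ ^ 2 + B₂ ^ 2 * v₂ ^ 2))
      + (3 + 2 * Real.sqrt 3) * (3 * ((u₁ ^ 4 + u₂ ^ 4 + u₃ ^ 4 + u₄ ^ 4) - (v₁ ^ 4 + v₂ ^ 4)) - (3 / 2) * ((u₁ ^ 2 + u₂ ^ 2 + u₃ ^ 2 + u₄ ^ 2) - (v₁ ^ 2 + v₂ ^ 2)) ^ 2) = 0)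
    (hpos : 0 < (1 / 2) * ((A₁ ^ 2 + A₂ ^ 2 + A₃ ^ 2 + A₄ ^ 2) - (B₁ ^ 2 + B₂ ^ 2)) * ((u₁ ^ 2 + u₂ ^ 2 + u₃ ^ 2 + u₄ ^ 2) - (v₁ ^ 2 + v₂ ^ 2))
        + ((A₁ * u₁ + A₂ * u₂ + A₃ * u₃ + A₄ * u₄) - (B₁ * v₁ + B₂ * v₂)) ^ 2
        - 3 * ((A₁ ^ 2 * u₁ ^ 2 + A₂ ^ 2 * u₂ ^ 2 + A₃ ^ 2 * u₃ ^ 2 + A₄ ^ 2 * u₄ ^ 2) - (B₁ ^ 2 * v₁ ^ 2 + B₂ ^ 2 * v₂ ^ 2)))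
    :
    ∃ A₀ u₀ : ℝ, (u₁ - u₀) ^ 2 = (A₁ - A₀) ^ 2 ∧ (u₂ - u₀) ^ 2 = (A₂ - A₀) ^ 2 ∧ (u₃ - u₀) ^ 2 = (A₃ - A₀) ^ 2 ∧ (u₄ - u₀) ^ 2 = (A₄ - A₀) ^ 2 ∧ (v₁ - u₀) ^ 2 = (B₁ - A₀) ^ 2 ∧ (v₂ - u₀) ^ 2 = (B₂ - A₀) ^ 2 := by
  obtain ⟨hL2, hL3⟩ := sharp_const_facts
  by_cases hlo : v₁ ≤ u₁
  · exact crossMax_42_onesided A₁ A₂ A₃ A₄ B₁ B₂ u₁ u₂ u₃ u₄ v₁ v₂ hA hC hP1 hP2 hP4 m₁₁ m₂₁ m₃₁ m₄₁ m₁₂ m₂₂ m₃₂ m₄₂ o₁₂ o₂₃ o₃₄ ov hlo hQ hpos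
  by_cases hhi : u₄ ≤ v₂
  · -- reflect (u ↦ −u, E-order reversed, F-roots swapped); the vertex reflects back
    obtain ⟨A₀, u₀, k₄, k₃, k₂, k₁, kF₂, kF₁⟩ := crossMax_42_onesided A₄ A₃ A₂ A₁ B₂ B₁ (-u₄) (-u₃) (-u₂) (-u₁) (-v₂) (-v₁)
      (by linarith) (by linarith) (by linear_combination -hP1) (by linear_combination hP2) (by linear_combination -hP4)
      (by rw [show -u₄ - -v₂ = -(u₄ - v₂) by ring, abs_neg]; exact m₄₂)
      (by rw [show -u₃ - -v₂ = -(u₃ - v₂) by ring, abs_neg]; exact m₃₂)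
      (by rw [show -u₂ - -v₂ = -(u₂ - v₂) by ring, abs_neg]; exact m₂₂)
      (by rw [show -u₁ - -v₂ = -(u₁ - v₂) by ring, abs_neg]; exact m₁₂)
      (by rw [show -u₄ - -v₁ = -(u₄ - v₁) by ring, abs_neg]; exact m₄₁)
      (by rw [show -u₃ - -v₁ = -(u₃ - v₁) by ring, abs_neg]; exact m₃₁)
      (by rw [show -u₂ - -v₁ = -(u₂ - v₁) by ring, abs_neg]; exact m₂₁)
      (by rw [show -u₁ - -v₁ = -(u₁ - v₁) by ring, abs_neg]; exact m₁₁)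
      (by linarith) (by linarith) (by linarith) (by linarith) (by linarith)
      (by linear_combination hQ) (hpos.trans_eq (by ring))
    refine ⟨A₀, -u₀, ?_, ?_, ?_, ?_, ?_, ?_⟩
    · rw [show (u₁ - -u₀) ^ 2 = (-u₁ - u₀) ^ 2 by ring]; exact k₁
    · rw [show (u₂ - -u₀) ^ 2 = (-u₂ - u₀) ^ 2 by ring]; exact k₂
    · rw [show (u₃ - -u₀) ^ 2 = (-u₃ - u₀) ^ 2 by ring]; exact k₃
    · rw [show (u₄ - -u₀) ^ 2 = (-u₄ - u₀) ^ 2 by ring]; exact k₄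
    · rw [show (v₁ - -u₀) ^ 2 = (-v₁ - u₀) ^ 2 by ring]; exact kF₁
    · rw [show (v₂ - -u₀) ^ 2 = (-v₂ - u₀) ^ 2 by ring]; exact kF₂
  push Not at hlo hhi
  exfalso
  have hLpos : 0 < (3 + 2 * Real.sqrt 3) := by linarith
  rcases lt_trichotomy ((u₁ - v₁) * (u₂ - v₁) * (u₃ - v₁) * (u₄ - v₁)) 0 with hK | hK | hK
  · have hb4 : 0 < u₄ - v₁ := by linarith
    have h123 : (u₁ - v₁) * (u₂ - v₁) * (u₃ - v₁) < 0 := by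
      by_contra h
      push Not at h
      have := mul_nonneg h hb4.le
      linarith
    have h23 : 0 < (u₂ - v₁) * (u₃ - v₁) := by
      by_contra h
      push Not at h
      have e : (u₁ - v₁) * (u₂ - v₁) * (u₃ - v₁) = (u₁ - v₁) * ((u₂ - v₁) * (u₃ - v₁)) := by ring
      have := mul_nonneg_of_nonpos_of_nonpos (by linarith : u₁ - v₁ ≤ 0) h
      linarith
    rcases lt_or_ge v₁ u₂ with h2 | h2
    · have hK' : (u₁ - v₂) * (u₂ - v₂) * (u₃ - v₂) * (u₄ - v₂) < 0 := by
        have h := K0_F1_sub_K0_F2 u₁ u₂ u₃ u₄ v₁ v₂ hC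
        rw [hP4] at h
        linarith
      have hb4' : 0 < u₄ - v₂ := by linarith
      have h123' : (u₁ - v₂) * (u₂ - v₂) * (u₃ - v₂) < 0 := by
        by_contra h
        push Not at h
        have := mul_nonneg h hb4'.le
        linarith
      have h23' : 0 < (u₂ - v₂) * (u₃ - v₂) := by
        by_contra h
        push Not at h
        have e : (u₁ - v₂) * (u₂ - v₂) * (u₃ - v₂) = (u₁ - v₂) * ((u₂ - v₂) * (u₃ - v₂)) := by ring
        have := mul_nonneg_of_nonpos_of_nonpos (by linarith : u₁ - v₂ ≤ 0) h
        linarith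
      rcases lt_or_ge u₃ v₂ with h3 | h3
      · obtain ⟨hq2, hq4⟩ := Q2_Q4_nonneg_pattern_EFEEFE A₁ A₂ A₃ A₄ B₁ B₂ u₁ u₂ u₃ u₄ v₁ v₂ hA hC hP1 hP2 hP4 m₁₁ m₂₁ m₃₁ m₄₁ m₁₂ m₂₂ m₃₂ m₄₂
          hlo h2 (by linarith) (by linarith) h3 hhi
        have := mul_nonneg hLpos.le hq4
        linarith
      · have hu3 : v₂ < u₃ := by
          rcases eq_or_lt_of_le h3 with g | g
          · exfalso; rw [g, sub_self, mul_zero] at h23'; exact lt_irrefl _ h23'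
          · exact g
        have hu2 : v₂ < u₂ := by
          by_contra h
          push Not at h
          have := mul_nonpos_of_nonpos_of_nonneg (by linarith : u₂ - v₂ ≤ 0) (by linarith : 0 ≤ u₃ - v₂)
          linarith
        exact no_config_K_neg_none_between A₁ A₂ A₃ A₄ B₁ B₂ u₁ u₂ u₃ u₄ v₁ v₂ hA hC hP2 hP4 m₁₁ m₂₁ m₃₁ m₄₁ m₁₂ m₂₂ m₃₂ m₄₂ hK
          (mul_pos_of_neg_of_neg (by linarith) (by linarith)) (mul_pos (by linarith) (by linarith))
          (mul_pos (by linarith) (by linarith)) (mul_pos (by linarith) (by linarith))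
    · have hu2 : u₂ < v₁ := by
        rcases eq_or_lt_of_le h2 with g | g
        · exfalso; rw [← g, sub_self, zero_mul] at h23; exact lt_irrefl _ h23
        · exact g
      have hu3 : u₃ < v₁ := by
        by_contra h
        push Not at h
        have := mul_nonpos_of_nonpos_of_nonneg (by linarith : u₂ - v₁ ≤ 0) (by linarith : 0 ≤ u₃ - v₁)
        linarith
      exact no_config_K_neg_none_between A₁ A₂ A₃ A₄ B₁ B₂ u₁ u₂ u₃ u₄ v₁ v₂ hA hC hP2 hP4 m₁₁ m₂₁ m₃₁ m₄₁ m₁₂ m₂₂ m₃₂ m₄₂ hK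
        (mul_pos_of_neg_of_neg (by linarith) (by linarith)) (mul_pos_of_neg_of_neg (by linarith) (by linarith))
        (mul_pos_of_neg_of_neg (by linarith) (by linarith)) (mul_pos (by linarith) (by linarith))
  · -- K = 0: Q₄ = 0, hence Q₂ = 0
    have hQ4 := Q4_eq_F1 u₁ u₂ u₃ u₄ v₁ v₂ hC
    rw [hP4, hK] at hQ4
    have hq4 : 3 * ((u₁ ^ 4 + u₂ ^ 4 + u₃ ^ 4 + u₄ ^ 4) - (v₁ ^ 4 + v₂ ^ 4)) - (3 / 2) * ((u₁ ^ 2 + u₂ ^ 2 + u₃ ^ 2 + u₄ ^ 2) - (v₁ ^ 2 + v₂ ^ 2)) ^ 2 = 0 := by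
      rw [hQ4]; ring
    rw [hq4, mul_zero, add_zero] at hQ
    linarith
  · exact no_config_K_pos_split A₁ A₂ A₃ A₄ B₁ B₂ u₁ u₂ u₃ u₄ v₁ v₂ hA hC hP2 hP4 m₁₁ m₂₁ m₃₁ m₄₁ m₁₂ m₂₂ m₃₂ m₄₂
      o₁₂ (by linarith) (by linarith) o₃₄ ov hlo hhi hK

/-- Sorting step: `u₁ ≤ u₂ ≤ u₃`, `v₁ ≤ v₂`, `u₄` arbitrary. -/
theorem crossMax_42_sorted3 (A₁ A₂ A₃ A₄ B₁ B₂ u₁ u₂ u₃ u₄ v₁ v₂ : ℝ)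
    (hA : A₁ + A₂ + A₃ + A₄ = B₁ + B₂) (hC : u₁ + u₂ + u₃ + u₄ = v₁ + v₂)
    (hP1 : (A₁ ^ 2 * u₁ + A₂ ^ 2 * u₂ + A₃ ^ 2 * u₃ + A₄ ^ 2 * u₄) - (B₁ ^ 2 * v₁ + B₂ ^ 2 * v₂) = 0)
    (hP2 : (A₁ * u₁ ^ 2 + A₂ * u₂ ^ 2 + A₃ * u₃ ^ 2 + A₄ * u₄ ^ 2) - (B₁ * v₁ ^ 2 + B₂ * v₂ ^ 2) = 0)
    (hP4 : (u₁ ^ 3 + u₂ ^ 3 + u₃ ^ 3 + u₄ ^ 3) - (v₁ ^ 3 + v₂ ^ 3) = 0)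
    (m₁₁ : |u₁ - v₁| ≤ A₁ - B₁) (m₂₁ : |u₂ - v₁| ≤ A₂ - B₁) (m₃₁ : |u₃ - v₁| ≤ A₃ - B₁) (m₄₁ : |u₄ - v₁| ≤ A₄ - B₁)
    (m₁₂ : |u₁ - v₂| ≤ A₁ - B₂) (m₂₂ : |u₂ - v₂| ≤ A₂ - B₂) (m₃₂ : |u₃ - v₂| ≤ A₃ - B₂) (m₄₂ : |u₄ - v₂| ≤ A₄ - B₂)
    (o₁₂ : u₁ ≤ u₂) (o₂₃ : u₂ ≤ u₃) (ov : v₁ ≤ v₂)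
    (hQ : (1 / 2) * ((A₁ ^ 2 + A₂ ^ 2 + A₃ ^ 2 + A₄ ^ 2) - (B₁ ^ 2 + B₂ ^ 2)) * ((u₁ ^ 2 + u₂ ^ 2 + u₃ ^ 2 + u₄ ^ 2) - (v₁ ^ 2 + v₂ ^ 2))
        + ((A₁ * u₁ + A₂ * u₂ + A₃ * u₃ + A₄ * u₄) - (B₁ * v₁ + B₂ * v₂)) ^ 2
        - 3 * ((A₁ ^ 2 * u₁ ^ 2 + A₂ ^ 2 * u₂ ^ 2 + A₃ ^ 2 * u₃ ^ 2 + A₄ ^ 2 * u₄ ^ 2) - (B₁ ^ 2 * v₁ ^ 2 + B₂ ^ 2 * v₂ ^ 2))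
      + (3 + 2 * Real.sqrt 3) * (3 * ((u₁ ^ 4 + u₂ ^ 4 + u₃ ^ 4 + u₄ ^ 4) - (v₁ ^ 4 + v₂ ^ 4)) - (3 / 2) * ((u₁ ^ 2 + u₂ ^ 2 + u₃ ^ 2 + u₄ ^ 2) - (v₁ ^ 2 + v₂ ^ 2)) ^ 2) = 0)
    (hpos : 0 < (1 / 2) * ((A₁ ^ 2 + A₂ ^ 2 + A₃ ^ 2 + A₄ ^ 2) - (B₁ ^ 2 + B₂ ^ 2)) * ((u₁ ^ 2 + u₂ ^ 2 + u₃ ^ 2 + u₄ ^ 2) - (v₁ ^ 2 + v₂ ^ 2))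
        + ((A₁ * u₁ + A₂ * u₂ + A₃ * u₃ + A₄ * u₄) - (B₁ * v₁ + B₂ * v₂)) ^ 2
        - 3 * ((A₁ ^ 2 * u₁ ^ 2 + A₂ ^ 2 * u₂ ^ 2 + A₃ ^ 2 * u₃ ^ 2 + A₄ ^ 2 * u₄ ^ 2) - (B₁ ^ 2 * v₁ ^ 2 + B₂ ^ 2 * v₂ ^ 2)))
    :
    ∃ A₀ u₀ : ℝ, (u₁ - u₀) ^ 2 = (A₁ - A₀) ^ 2 ∧ (u₂ - u₀) ^ 2 = (A₂ - A₀) ^ 2 ∧ (u₃ - u₀) ^ 2 = (A₃ - A₀) ^ 2 ∧ (u₄ - u₀) ^ 2 = (A₄ - A₀) ^ 2 ∧ (v₁ - u₀) ^ 2 = (B₁ - A₀) ^ 2 ∧ (v₂ - u₀) ^ 2 = (B₂ - A₀) ^ 2 := by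
  rcases le_total u₃ u₄ with o₃ | o₃
  · exact crossMax_42_sorted A₁ A₂ A₃ A₄ B₁ B₂ u₁ u₂ u₃ u₄ v₁ v₂ hA hC hP1 hP2 hP4 m₁₁ m₂₁ m₃₁ m₄₁ m₁₂ m₂₂ m₃₂ m₄₂ o₁₂ o₂₃ o₃ ov hQ hpos
  · rcases le_total u₂ u₄ with o₂ | o₂
    · obtain ⟨A₀, u₀, k₁, k₂, k₄, k₃, kF₁, kF₂⟩ := crossMax_42_sorted A₁ A₂ A₄ A₃ B₁ B₂ u₁ u₂ u₄ u₃ v₁ v₂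
        (by linarith) (by linarith) (by linarith [hP1]) (by linarith [hP2]) (by linarith [hP4])
        m₁₁ m₂₁ m₄₁ m₃₁ m₁₂ m₂₂ m₄₂ m₃₂ o₁₂ o₂ o₃ ov (by linear_combination hQ) (hpos.trans_eq (by ring))
      exact ⟨A₀, u₀, k₁, k₂, k₃, k₄, kF₁, kF₂⟩
    · rcases le_total u₁ u₄ with o₁ | o₁
      · obtain ⟨A₀, u₀, k₁, k₄, k₂, k₃, kF₁, kF₂⟩ := crossMax_42_sorted A₁ A₄ A₂ A₃ B₁ B₂ u₁ u₄ u₂ u₃ v₁ v₂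
          (by linarith) (by linarith) (by linarith [hP1]) (by linarith [hP2]) (by linarith [hP4])
          m₁₁ m₄₁ m₂₁ m₃₁ m₁₂ m₄₂ m₂₂ m₃₂ o₁ o₂ o₂₃ ov (by linear_combination hQ) (hpos.trans_eq (by ring))
        exact ⟨A₀, u₀, k₁, k₂, k₃, k₄, kF₁, kF₂⟩
      · obtain ⟨A₀, u₀, k₄, k₁, k₂, k₃, kF₁, kF₂⟩ := crossMax_42_sorted A₄ A₁ A₂ A₃ B₁ B₂ u₄ u₁ u₂ u₃ v₁ v₂
          (by linarith) (by linarith) (by linarith [hP1]) (by linarith [hP2]) (by linarith [hP4])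
          m₄₁ m₁₁ m₂₁ m₃₁ m₄₂ m₁₂ m₂₂ m₃₂ o₁ o₁₂ o₂₃ ov (by linear_combination hQ) (hpos.trans_eq (by ring))
        exact ⟨A₀, u₀, k₁, k₂, k₃, k₄, kF₁, kF₂⟩

/-- Sorting step: `u₁ ≤ u₂`, `v₁ ≤ v₂`. -/
theorem crossMax_42_sorted2 (A₁ A₂ A₃ A₄ B₁ B₂ u₁ u₂ u₃ u₄ v₁ v₂ : ℝ)
    (hA : A₁ + A₂ + A₃ + A₄ = B₁ + B₂) (hC : u₁ + u₂ + u₃ + u₄ = v₁ + v₂)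
    (hP1 : (A₁ ^ 2 * u₁ + A₂ ^ 2 * u₂ + A₃ ^ 2 * u₃ + A₄ ^ 2 * u₄) - (B₁ ^ 2 * v₁ + B₂ ^ 2 * v₂) = 0)
    (hP2 : (A₁ * u₁ ^ 2 + A₂ * u₂ ^ 2 + A₃ * u₃ ^ 2 + A₄ * u₄ ^ 2) - (B₁ * v₁ ^ 2 + B₂ * v₂ ^ 2) = 0)
    (hP4 : (u₁ ^ 3 + u₂ ^ 3 + u₃ ^ 3 + u₄ ^ 3) - (v₁ ^ 3 + v₂ ^ 3) = 0)
    (m₁₁ : |u₁ - v₁| ≤ A₁ - B₁) (m₂₁ : |u₂ - v₁| ≤ A₂ - B₁) (m₃₁ : |u₃ - v₁| ≤ A₃ - B₁) (m₄₁ : |u₄ - v₁| ≤ A₄ - B₁)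
    (m₁₂ : |u₁ - v₂| ≤ A₁ - B₂) (m₂₂ : |u₂ - v₂| ≤ A₂ - B₂) (m₃₂ : |u₃ - v₂| ≤ A₃ - B₂) (m₄₂ : |u₄ - v₂| ≤ A₄ - B₂)
    (o₁₂ : u₁ ≤ u₂) (ov : v₁ ≤ v₂)
    (hQ : (1 / 2) * ((A₁ ^ 2 + A₂ ^ 2 + A₃ ^ 2 + A₄ ^ 2) - (B₁ ^ 2 + B₂ ^ 2)) * ((u₁ ^ 2 + u₂ ^ 2 + u₃ ^ 2 + u₄ ^ 2) - (v₁ ^ 2 + v₂ ^ 2))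
        + ((A₁ * u₁ + A₂ * u₂ + A₃ * u₃ + A₄ * u₄) - (B₁ * v₁ + B₂ * v₂)) ^ 2
        - 3 * ((A₁ ^ 2 * u₁ ^ 2 + A₂ ^ 2 * u₂ ^ 2 + A₃ ^ 2 * u₃ ^ 2 + A₄ ^ 2 * u₄ ^ 2) - (B₁ ^ 2 * v₁ ^ 2 + B₂ ^ 2 * v₂ ^ 2))
      + (3 + 2 * Real.sqrt 3) * (3 * ((u₁ ^ 4 + u₂ ^ 4 + u₃ ^ 4 + u₄ ^ 4) - (v₁ ^ 4 + v₂ ^ 4)) - (3 / 2) * ((u₁ ^ 2 + u₂ ^ 2 + u₃ ^ 2 + u₄ ^ 2) - (v₁ ^ 2 + v₂ ^ 2)) ^ 2) = 0)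
    (hpos : 0 < (1 / 2) * ((A₁ ^ 2 + A₂ ^ 2 + A₃ ^ 2 + A₄ ^ 2) - (B₁ ^ 2 + B₂ ^ 2)) * ((u₁ ^ 2 + u₂ ^ 2 + u₃ ^ 2 + u₄ ^ 2) - (v₁ ^ 2 + v₂ ^ 2))
        + ((A₁ * u₁ + A₂ * u₂ + A₃ * u₃ + A₄ * u₄) - (B₁ * v₁ + B₂ * v₂)) ^ 2
        - 3 * ((A₁ ^ 2 * u₁ ^ 2 + A₂ ^ 2 * u₂ ^ 2 + A₃ ^ 2 * u₃ ^ 2 + A₄ ^ 2 * u₄ ^ 2) - (B₁ ^ 2 * v₁ ^ 2 + B₂ ^ 2 * v₂ ^ 2)))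
    :
    ∃ A₀ u₀ : ℝ, (u₁ - u₀) ^ 2 = (A₁ - A₀) ^ 2 ∧ (u₂ - u₀) ^ 2 = (A₂ - A₀) ^ 2 ∧ (u₃ - u₀) ^ 2 = (A₃ - A₀) ^ 2 ∧ (u₄ - u₀) ^ 2 = (A₄ - A₀) ^ 2 ∧ (v₁ - u₀) ^ 2 = (B₁ - A₀) ^ 2 ∧ (v₂ - u₀) ^ 2 = (B₂ - A₀) ^ 2 := by
  rcases le_total u₂ u₃ with o₂ | o₂
  · exact crossMax_42_sorted3 A₁ A₂ A₃ A₄ B₁ B₂ u₁ u₂ u₃ u₄ v₁ v₂ hA hC hP1 hP2 hP4 m₁₁ m₂₁ m₃₁ m₄₁ m₁₂ m₂₂ m₃₂ m₄₂ o₁₂ o₂ ov hQ hpos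
  · rcases le_total u₁ u₃ with o₁ | o₁
    · obtain ⟨A₀, u₀, k₁, k₃, k₂, k₄, kF₁, kF₂⟩ := crossMax_42_sorted3 A₁ A₃ A₂ A₄ B₁ B₂ u₁ u₃ u₂ u₄ v₁ v₂
        (by linarith) (by linarith) (by linarith [hP1]) (by linarith [hP2]) (by linarith [hP4])
        m₁₁ m₃₁ m₂₁ m₄₁ m₁₂ m₃₂ m₂₂ m₄₂ o₁ o₂ ov (by linear_combination hQ) (hpos.trans_eq (by ring))
      exact ⟨A₀, u₀, k₁, k₂, k₃, k₄, kF₁, kF₂⟩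
    · obtain ⟨A₀, u₀, k₃, k₁, k₂, k₄, kF₁, kF₂⟩ := crossMax_42_sorted3 A₃ A₁ A₂ A₄ B₁ B₂ u₃ u₁ u₂ u₄ v₁ v₂
        (by linarith) (by linarith) (by linarith [hP1]) (by linarith [hP2]) (by linarith [hP4])
        m₃₁ m₁₁ m₂₁ m₄₁ m₃₂ m₁₂ m₂₂ m₄₂ o₁ o₁₂ ov (by linear_combination hQ) (hpos.trans_eq (by ring))
      exact ⟨A₀, u₀, k₁, k₂, k₃, k₄, kF₁, kF₂⟩

/-- Sorting step: `v₁ ≤ v₂` only. -/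
theorem crossMax_42_vsorted (A₁ A₂ A₃ A₄ B₁ B₂ u₁ u₂ u₃ u₄ v₁ v₂ : ℝ)
    (hA : A₁ + A₂ + A₃ + A₄ = B₁ + B₂) (hC : u₁ + u₂ + u₃ + u₄ = v₁ + v₂)
    (hP1 : (A₁ ^ 2 * u₁ + A₂ ^ 2 * u₂ + A₃ ^ 2 * u₃ + A₄ ^ 2 * u₄) - (B₁ ^ 2 * v₁ + B₂ ^ 2 * v₂) = 0)
    (hP2 : (A₁ * u₁ ^ 2 + A₂ * u₂ ^ 2 + A₃ * u₃ ^ 2 + A₄ * u₄ ^ 2) - (B₁ * v₁ ^ 2 + B₂ * v₂ ^ 2) = 0)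
    (hP4 : (u₁ ^ 3 + u₂ ^ 3 + u₃ ^ 3 + u₄ ^ 3) - (v₁ ^ 3 + v₂ ^ 3) = 0)
    (m₁₁ : |u₁ - v₁| ≤ A₁ - B₁) (m₂₁ : |u₂ - v₁| ≤ A₂ - B₁) (m₃₁ : |u₃ - v₁| ≤ A₃ - B₁) (m₄₁ : |u₄ - v₁| ≤ A₄ - B₁)
    (m₁₂ : |u₁ - v₂| ≤ A₁ - B₂) (m₂₂ : |u₂ - v₂| ≤ A₂ - B₂) (m₃₂ : |u₃ - v₂| ≤ A₃ - B₂) (m₄₂ : |u₄ - v₂| ≤ A₄ - B₂)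
    (ov : v₁ ≤ v₂)
    (hQ : (1 / 2) * ((A₁ ^ 2 + A₂ ^ 2 + A₃ ^ 2 + A₄ ^ 2) - (B₁ ^ 2 + B₂ ^ 2)) * ((u₁ ^ 2 + u₂ ^ 2 + u₃ ^ 2 + u₄ ^ 2) - (v₁ ^ 2 + v₂ ^ 2))
        + ((A₁ * u₁ + A₂ * u₂ + A₃ * u₃ + A₄ * u₄) - (B₁ * v₁ + B₂ * v₂)) ^ 2
        - 3 * ((A₁ ^ 2 * u₁ ^ 2 + A₂ ^ 2 * u₂ ^ 2 + A₃ ^ 2 * u₃ ^ 2 + A₄ ^ 2 * u₄ ^ 2) - (B₁ ^ 2 * v₁ ^ 2 + B₂ ^ 2 * v₂ ^ 2))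
      + (3 + 2 * Real.sqrt 3) * (3 * ((u₁ ^ 4 + u₂ ^ 4 + u₃ ^ 4 + u₄ ^ 4) - (v₁ ^ 4 + v₂ ^ 4)) - (3 / 2) * ((u₁ ^ 2 + u₂ ^ 2 + u₃ ^ 2 + u₄ ^ 2) - (v₁ ^ 2 + v₂ ^ 2)) ^ 2) = 0)
    (hpos : 0 < (1 / 2) * ((A₁ ^ 2 + A₂ ^ 2 + A₃ ^ 2 + A₄ ^ 2) - (B₁ ^ 2 + B₂ ^ 2)) * ((u₁ ^ 2 + u₂ ^ 2 + u₃ ^ 2 + u₄ ^ 2) - (v₁ ^ 2 + v₂ ^ 2))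
        + ((A₁ * u₁ + A₂ * u₂ + A₃ * u₃ + A₄ * u₄) - (B₁ * v₁ + B₂ * v₂)) ^ 2
        - 3 * ((A₁ ^ 2 * u₁ ^ 2 + A₂ ^ 2 * u₂ ^ 2 + A₃ ^ 2 * u₃ ^ 2 + A₄ ^ 2 * u₄ ^ 2) - (B₁ ^ 2 * v₁ ^ 2 + B₂ ^ 2 * v₂ ^ 2)))
    :
    ∃ A₀ u₀ : ℝ, (u₁ - u₀) ^ 2 = (A₁ - A₀) ^ 2 ∧ (u₂ - u₀) ^ 2 = (A₂ - A₀) ^ 2 ∧ (u₃ - u₀) ^ 2 = (A₃ - A₀) ^ 2 ∧ (u₄ - u₀) ^ 2 = (A₄ - A₀) ^ 2 ∧ (v₁ - u₀) ^ 2 = (B₁ - A₀) ^ 2 ∧ (v₂ - u₀) ^ 2 = (B₂ - A₀) ^ 2 := by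
  rcases le_total u₁ u₂ with o₁ | o₁
  · exact crossMax_42_sorted2 A₁ A₂ A₃ A₄ B₁ B₂ u₁ u₂ u₃ u₄ v₁ v₂ hA hC hP1 hP2 hP4 m₁₁ m₂₁ m₃₁ m₄₁ m₁₂ m₂₂ m₃₂ m₄₂ o₁ ov hQ hpos
  · obtain ⟨A₀, u₀, k₂, k₁, k₃, k₄, kF₁, kF₂⟩ := crossMax_42_sorted2 A₂ A₁ A₃ A₄ B₁ B₂ u₂ u₁ u₃ u₄ v₁ v₂
      (by linarith) (by linarith) (by linarith [hP1]) (by linarith [hP2]) (by linarith [hP4])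
      m₂₁ m₁₁ m₃₁ m₄₁ m₂₂ m₁₂ m₃₂ m₄₂ o₁ ov (by linear_combination hQ) (hpos.trans_eq (by ring))
    exact ⟨A₀, u₀, k₁, k₂, k₃, k₄, kF₁, kF₂⟩

/-- **CROSS-MAX IN FORMAT (4,2) (GAPS G51b′).** For a centred, pure (P1, P2, P4), pairwise-ample real (4,2) configuration with
`Q₂ + (3 + 2√3)·Q₄ = 0` and `Q₂ > 0` — i.e. a maximiser of `−Q₄/Q₂` (value `2/√3 − 1`, `conjectureN_42_sharp`) — all six roots are
null-separated from one vertex: the configuration is a cross (null-cone) configuration (`CONJECTURE-N.md` §3). -/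
theorem crossMax_42 (A₁ A₂ A₃ A₄ B₁ B₂ u₁ u₂ u₃ u₄ v₁ v₂ : ℝ)
    (hA : A₁ + A₂ + A₃ + A₄ = B₁ + B₂) (hC : u₁ + u₂ + u₃ + u₄ = v₁ + v₂)
    (hP1 : (A₁ ^ 2 * u₁ + A₂ ^ 2 * u₂ + A₃ ^ 2 * u₃ + A₄ ^ 2 * u₄) - (B₁ ^ 2 * v₁ + B₂ ^ 2 * v₂) = 0)
    (hP2 : (A₁ * u₁ ^ 2 + A₂ * u₂ ^ 2 + A₃ * u₃ ^ 2 + A₄ * u₄ ^ 2) - (B₁ * v₁ ^ 2 + B₂ * v₂ ^ 2) = 0)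
    (hP4 : (u₁ ^ 3 + u₂ ^ 3 + u₃ ^ 3 + u₄ ^ 3) - (v₁ ^ 3 + v₂ ^ 3) = 0)
    (m₁₁ : |u₁ - v₁| ≤ A₁ - B₁) (m₂₁ : |u₂ - v₁| ≤ A₂ - B₁) (m₃₁ : |u₃ - v₁| ≤ A₃ - B₁) (m₄₁ : |u₄ - v₁| ≤ A₄ - B₁)
    (m₁₂ : |u₁ - v₂| ≤ A₁ - B₂) (m₂₂ : |u₂ - v₂| ≤ A₂ - B₂) (m₃₂ : |u₃ - v₂| ≤ A₃ - B₂) (m₄₂ : |u₄ - v₂| ≤ A₄ - B₂)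
    (hQ : (1 / 2) * ((A₁ ^ 2 + A₂ ^ 2 + A₃ ^ 2 + A₄ ^ 2) - (B₁ ^ 2 + B₂ ^ 2)) * ((u₁ ^ 2 + u₂ ^ 2 + u₃ ^ 2 + u₄ ^ 2) - (v₁ ^ 2 + v₂ ^ 2))
        + ((A₁ * u₁ + A₂ * u₂ + A₃ * u₃ + A₄ * u₄) - (B₁ * v₁ + B₂ * v₂)) ^ 2
        - 3 * ((A₁ ^ 2 * u₁ ^ 2 + A₂ ^ 2 * u₂ ^ 2 + A₃ ^ 2 * u₃ ^ 2 + A₄ ^ 2 * u₄ ^ 2) - (B₁ ^ 2 * v₁ ^ 2 + B₂ ^ 2 * v₂ ^ 2))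
      + (3 + 2 * Real.sqrt 3) * (3 * ((u₁ ^ 4 + u₂ ^ 4 + u₃ ^ 4 + u₄ ^ 4) - (v₁ ^ 4 + v₂ ^ 4)) - (3 / 2) * ((u₁ ^ 2 + u₂ ^ 2 + u₃ ^ 2 + u₄ ^ 2) - (v₁ ^ 2 + v₂ ^ 2)) ^ 2) = 0)
    (hpos : 0 < (1 / 2) * ((A₁ ^ 2 + A₂ ^ 2 + A₃ ^ 2 + A₄ ^ 2) - (B₁ ^ 2 + B₂ ^ 2)) * ((u₁ ^ 2 + u₂ ^ 2 + u₃ ^ 2 + u₄ ^ 2) - (v₁ ^ 2 + v₂ ^ 2))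
        + ((A₁ * u₁ + A₂ * u₂ + A₃ * u₃ + A₄ * u₄) - (B₁ * v₁ + B₂ * v₂)) ^ 2
        - 3 * ((A₁ ^ 2 * u₁ ^ 2 + A₂ ^ 2 * u₂ ^ 2 + A₃ ^ 2 * u₃ ^ 2 + A₄ ^ 2 * u₄ ^ 2) - (B₁ ^ 2 * v₁ ^ 2 + B₂ ^ 2 * v₂ ^ 2)))
    :
    ∃ A₀ u₀ : ℝ, (u₁ - u₀) ^ 2 = (A₁ - A₀) ^ 2 ∧ (u₂ - u₀) ^ 2 = (A₂ - A₀) ^ 2 ∧ (u₃ - u₀) ^ 2 = (A₃ - A₀) ^ 2 ∧ (u₄ - u₀) ^ 2 = (A₄ - A₀) ^ 2 ∧ (v₁ - u₀) ^ 2 = (B₁ - A₀) ^ 2 ∧ (v₂ - u₀) ^ 2 = (B₂ - A₀) ^ 2 := by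
  rcases le_total v₁ v₂ with ov | ov
  · exact crossMax_42_vsorted A₁ A₂ A₃ A₄ B₁ B₂ u₁ u₂ u₃ u₄ v₁ v₂ hA hC hP1 hP2 hP4 m₁₁ m₂₁ m₃₁ m₄₁ m₁₂ m₂₂ m₃₂ m₄₂ ov hQ hpos
  · obtain ⟨A₀, u₀, k₁, k₂, k₃, k₄, kF₂, kF₁⟩ := crossMax_42_vsorted A₁ A₂ A₃ A₄ B₂ B₁ u₁ u₂ u₃ u₄ v₂ v₁
      (by linarith) (by linarith) (by linarith [hP1]) (by linarith [hP2]) (by linarith [hP4])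
      m₁₂ m₂₂ m₃₂ m₄₂ m₁₁ m₂₁ m₃₁ m₄₁ ov (by linear_combination hQ) (hpos.trans_eq (by ring))
    exact ⟨A₀, u₀, k₁, k₂, k₃, k₄, kF₁, kF₂⟩

end Summit.HodgeConjecture.HodgeConjecture.WeilClassTestFormatFourTwoLambda
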